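import Literature.ModelTheory.FiniteModelTheory.CohomologicalConsistencyThreeColouring
import Literature.ModelTheory.FiniteModelTheory.SparseBoundedDegreeFooling
import Literature.Combinatorics.SimpleGraph.RandomLiftExistence
import Literature.Combinatorics.SimpleGraph.LiftIndependenceNumerics
import Literature.Combinatorics.SimpleGraph.DisjointUnionTransfer
import HarnessLib

/-!
# Proof of Conneryd–Ghannane–Pang 2025, Theorem 6.1 (`connerydGhannanePang2025_thm_6_1_holds`)

Topic `Literature/ModelTheory/FiniteModelTheory`.  (This sibling is named `…Holds` because the
`…Proofs` sibling holds the upstream ingredients Def. 6.3 / Lemma 6.5 and is imported by the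
whole chain below, so it cannot import that chain.)  DISCHARGE of the named fact
`connerydGhannanePang2025_thm_6_1` (arXiv:2511.17272, Thm. 6.1, in the deterministic-consequence
rendering of `CohomologicalConsistencyThreeColouring.lean`): there is `C > 0` (`C = 17`) such
that for every `d ≥ 10` and all large `n` with `dn` even some `d`-regular simple graph on `Fin n`
is not `m`-colourable for any `m ≤ d/(4 log₂ d)` and is cohomologically `k`-consistent w.r.t.
`K₃` for every `k ≤ n·d^{-Cd}`.

The proof follows the source (§6): a sparse `d`-regular graph of small chromatic window is fed
to the deterministic core `graphCohomologicallyKConsistent_of_sparse_of_degree_le`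
(`SparseBoundedDegreeFooling.lean`, = Lemmas 4.4, 6.5–6.8 of the source with [CdRNPR25]).  The
random-graph input (Lemmas 6.2, 6.4, there for `𝒢_{n,d}`) is replaced by RANDOM LIFTS
(`RandomLiftExistence.lean`): `G` is the disjoint union of a lift of `K_{d+1}` with fibres of size
`a` (no independent `⌈(d+1)a/m₀⌉`-set, `m₀ = ⌊d/(4 log₂ d)⌋`, and locally sparse) and a lift of
`K_{d,d}` (`completeBipartiteFin d`) with fibres of size `b` (locally sparse), where
`n = a(d+1) + b·2d` with `a, b ≥ n/(6d+2) - 1` (`exists_repr`); both lifts are simple and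
`d`-regular, sparsity and regularity pass to the union (`DisjointUnionTransfer.lean`), and an
`m₀`-colouring of the union would give a large independent set in the first lift (pigeonhole).

## References

* [ConnerydGhannanePang2025] arXiv:2511.17272, §6, Thm. 6.1 with Lemmas 6.2, 6.4–6.8. READ.
* [CdRNPR25] arXiv:2503.17022 (the closure / reducibility machinery, formalised upstream). READ.
-/

noncomputable section

namespace Literature.ModelTheory.FiniteModelTheory

namespace ConnerydGhannanePang

open Finset _root_.Filter Literature.Combinatorics.SimpleGraph

/-! ### Writing `n = a(d+1) + b·2d` with `a, b` large -/

/-- `n = a(d+1) + b(2d)` for `n ≥ 2d(d+1)` with `dn` even. [folklore] -/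
theorem exists_repr_aux {d n : ℕ} (hd : 1 ≤ d) (hdn : Even (d * n)) (hn : 2 * d * (d + 1) ≤ n) :
    ∃ a b : ℕ, n = a * (d + 1) + b * (2 * d) := by
  set c₀ := n / (d + 1) with hc₀
  set r := n % (d + 1) with hr
  have h1 : (d + 1) * c₀ + r = n := Nat.div_add_mod n (d + 1)
  have hrlt : r < d + 1 := Nat.mod_lt n (by omega)
  have hc₀d : 2 * d ≤ c₀ := by
    rw [hc₀, Nat.le_div_iff_mul_le (by omega)]; linarith
  by_cases hpar : (d + 1 - r) % 2 = 0
  · -- `2b = d + 1 - r`, `a = c₀ + 1 - 2b`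
    set b := (d + 1 - r) / 2 with hb
    have hb2 : r + 2 * b = d + 1 := by omega
    obtain ⟨a, ha⟩ : ∃ a, c₀ + 1 = 2 * b + a := Nat.exists_eq_add_of_le (by omega)
    refine ⟨a, b, ?_⟩
    have h1' : (((d + 1) * c₀ + r : ℕ) : ℤ) = n := by exact_mod_cast h1
    have ha' : ((c₀ + 1 : ℕ) : ℤ) = ((2 * b + a : ℕ) : ℤ) := by exact_mod_cast ha
    have hb' : ((r + 2 * b : ℕ) : ℤ) = ((d + 1 : ℕ) : ℤ) := by exact_mod_cast hb2
    push_cast at h1' ha' hb'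
    have key : (n : ℤ) = a * (d + 1) + b * (2 * d) := by linear_combination -h1' + ((d : ℤ) + 1) * ha' + hb'
    exact_mod_cast key
  · -- then `r` is even: `2b = 2(d+1) - r`, `a = c₀ + 2 - 2b`
    have hr0 : r % 2 = 0 := by
      rcases Nat.even_or_odd (d + 1) with he | ho
      · have hn0 : n % 2 = 0 := by
          rcases Nat.even_mul.1 hdn with hd' | hn'
          · exact absurd (Nat.even_add_one.1 he) (not_not.2 hd')
          · exact Nat.even_iff.1 hn'
        rw [hr, Nat.mod_mod_of_dvd n he.two_dvd]
        exact hn0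
      · have := Nat.odd_iff.1 ho
        omega
    set b := d + 1 - r / 2 with hb
    have hb2 : r + 2 * b = 2 * (d + 1) := by omega
    obtain ⟨a, ha⟩ : ∃ a, c₀ + 2 = 2 * b + a := Nat.exists_eq_add_of_le (by omega)
    refine ⟨a, b, ?_⟩
    have h1' : (((d + 1) * c₀ + r : ℕ) : ℤ) = n := by exact_mod_cast h1
    have ha' : ((c₀ + 2 : ℕ) : ℤ) = ((2 * b + a : ℕ) : ℤ) := by exact_mod_cast ha
    have hb' : ((r + 2 * b : ℕ) : ℤ) = ((2 * (d + 1) : ℕ) : ℤ) := by exact_mod_cast hb2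
    push_cast at h1' ha' hb'
    have key : (n : ℤ) = a * (d + 1) + b * (2 * d) := by linear_combination -h1' + ((d : ℤ) + 1) * ha' + hb'
    exact_mod_cast key

/-- **Balanced representation**: `n = a(d+1) + b(2d)` with `(6d+2)a + 6d + 1 ≥ n` and the same
for `b`, for `n ≥ 8(d+1)²` with `dn` even. [folklore] -/
theorem exists_repr {d n : ℕ} (hd : 1 ≤ d) (hdn : Even (d * n)) (hn : 8 * (d + 1) ^ 2 ≤ n) :
    ∃ a b : ℕ, n = a * (d + 1) + b * (2 * d) ∧ n ≤ (6 * d + 2) * a + (6 * d + 1) ∧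
      n ≤ (6 * d + 2) * b + (6 * d + 1) := by
  set M := n / (6 * d + 2) with hM
  have hM1 : (6 * d + 2) * M ≤ n := Nat.mul_div_le n (6 * d + 2)
  have hM2 : n < (6 * d + 2) * (M + 1) := Nat.lt_mul_div_succ n (by omega)
  set n' := n - M * (3 * d + 1) with hn'
  have hn'le : M * (3 * d + 1) ≤ n := by linarith
  have hn'eq : n = n' + M * (3 * d + 1) := by omega
  have hn'ge : 2 * d * (d + 1) ≤ n' := by
    have : 2 * (M * (3 * d + 1)) ≤ n := by linarith
    have h4 : 4 * (d + 1) ^ 2 ≤ n' := by omega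
    nlinarith
  have hdn' : Even (d * n') := by
    have h3 : Even (d * (M * (3 * d + 1))) := by
      rcases Nat.even_or_odd d with he | ho
      · exact he.mul_right _
      · have : Even (3 * d + 1) := by
          rw [Nat.even_add_one, Nat.not_even_iff_odd]
          exact Nat.odd_mul.2 ⟨by decide, ho⟩
        exact (this.mul_left M).mul_left d
    have hsub : d * n' = d * n - d * (M * (3 * d + 1)) := by
      rw [hn', Nat.mul_sub]
    rw [hsub, Nat.even_sub (Nat.mul_le_mul_left d hn'le)]
    exact ⟨fun _ => h3, fun _ => hdn⟩
  obtain ⟨a', b', hab⟩ := exists_repr_aux hd hdn' hn'ge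
  refine ⟨a' + M, b' + M, ?_, ?_, ?_⟩
  · rw [hn'eq, hab]; ring
  · nlinarith
  · nlinarith

/-! ### The crude constant bound -/

/-- For `d ≥ 10` and `q = 4d + 10`:
`2·(d+1)·d^d·(6d+16)·(16q(32d)^q)·(6d+2) ≤ d^{17d}`. [folklore] -/
theorem consts_le_pow {d : ℕ} (hd : 10 ≤ d) :
    2 * ((d + 1) * d ^ d * (6 * d + 16) * (16 * (4 * d + 10) * (32 * d) ^ (4 * d + 10)) * (6 * d + 2)) ≤
      d ^ (17 * d) := by
  have hd3 : d ^ 3 = d * d * d := by ring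
  have hd2 : d ^ 2 = d * d := by ring
  have h1 : 2 * (6 * d + 2) ≤ d ^ 3 := by rw [hd3]; nlinarith
  have h2 : d + 1 ≤ d ^ 2 := by rw [hd2]; nlinarith
  have h3 : 6 * d + 16 ≤ d ^ 2 := by rw [hd2]; nlinarith
  have h4 : 16 * (4 * d + 10) ≤ d ^ 3 := by rw [hd3]; nlinarith
  have h5 : 32 * d ≤ d ^ 3 := by rw [hd3]; nlinarith
  have h5' : (32 * d) ^ (4 * d + 10) ≤ (d ^ 3) ^ (4 * d + 10) := Nat.pow_le_pow_left h5 _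
  calc 2 * ((d + 1) * d ^ d * (6 * d + 16) * (16 * (4 * d + 10) * (32 * d) ^ (4 * d + 10)) * (6 * d + 2))
      = 2 * (6 * d + 2) * (d + 1) * d ^ d * (6 * d + 16) * (16 * (4 * d + 10)) * (32 * d) ^ (4 * d + 10) := by
        ring
    _ ≤ d ^ 3 * d ^ 2 * d ^ d * d ^ 2 * d ^ 3 * (d ^ 3) ^ (4 * d + 10) :=
        Nat.mul_le_mul (Nat.mul_le_mul (Nat.mul_le_mul (Nat.mul_le_mul (Nat.mul_le_mul h1 h2) le_rfl) h3) h4) h5'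
    _ = d ^ (13 * d + 40) := by rw [← pow_mul]; ring
    _ ≤ d ^ (17 * d) := Nat.pow_le_pow_right (by omega) (by omega)

/-! ### The `k`-range -/

/-- From `k ≤ n·d^{-17d}` (over `ℝ`) to `k·d^{17d} ≤ n`. [folklore] -/
theorem mul_pow_le_of_le_rpow {d n k : ℕ} (hd : 1 ≤ d)
    (hk : (k : ℝ) ≤ (n : ℝ) * (d : ℝ) ^ (-((17 : ℝ) * d))) : k * d ^ (17 * d) ≤ n := by
  have hd0 : (0 : ℝ) < d := by exact_mod_cast hd
  have hpow : (d : ℝ) ^ (-((17 : ℝ) * d)) = ((d : ℝ) ^ (17 * d))⁻¹ := by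
    rw [Real.rpow_neg hd0.le, show ((17 : ℝ) * d) = ((17 * d : ℕ) : ℝ) by push_cast; ring,
      Real.rpow_natCast]
  rw [hpow, ← div_eq_mul_inv, le_div_iff₀ (by positivity)] at hk
  exact_mod_cast hk

/-! ### Regularity of the assembled graph -/

section Assembly

variable {d a b n : ℕ}

/-- Degrees in the lift of `K_{d+1}`. [folklore] -/
theorem degree_lift_top (π : UpEdge (⊤ : _root_.SimpleGraph (Fin (d + 1))) → Equiv.Perm (Fin a))
    (x : Fin (d + 1) × Fin a) : (liftGraph π).degree x = d := by
  obtain ⟨x, i⟩ := x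
  rw [degree_liftGraph, _root_.SimpleGraph.complete_graph_degree, Fintype.card_fin, Nat.add_sub_cancel]

/-- Degrees in the lift of `K_{d,d}`. [folklore] -/
theorem degree_lift_half (π : UpEdge (completeBipartiteFin d) → Equiv.Perm (Fin b)) (x : Fin (2 * d) × Fin b) :
    (liftGraph π).degree x = d := by
  obtain ⟨x, i⟩ := x
  rw [degree_liftGraph, degree_completeBipartiteFin]

end Assembly

end ConnerydGhannanePang

/-! ### The theorem -/

open ConnerydGhannanePang Literature.Combinatorics.SimpleGraph in
/-- **Conneryd–Ghannane–Pang, Theorem 6.1** — DISCHARGE of the named fact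
`connerydGhannanePang2025_thm_6_1` with `C = 17`: for every `d ≥ 10` and all large `n` with `dn`
even there is a `d`-regular simple graph on `Fin n` which is not `m`-colourable for any
`m ≤ d/(4 log₂ d)` and is cohomologically `k`-consistent w.r.t. `K₃` for all `k ≤ n·d^{-17d}`.
[cite: ConnerydGhannanePang2025, Thm. 6.1 (proof, §6; random lifts in place of `𝒢_{n,d}`)] -/
theorem connerydGhannanePang2025_thm_6_1_holds : connerydGhannanePang2025_thm_6_1 := by
  classical
  refine ⟨17, by norm_num, fun d hd => ?_⟩
  -- constants depending on `d`
  set q := 4 * d + 10 with hq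
  set K := 16 * q * (32 * d) ^ q with hK
  set B' := (d + 1) * d ^ d * (2 * d + 5) * K * (6 * d + 2) + 6 * d + 1 with hB'
  set n₀ := 8 * (d + 1) ^ 2 + 2 * B' + (6 * d + 2) with hn₀
  rw [Filter.eventually_atTop]
  refine ⟨n₀, fun n hn hdn => ?_⟩
  have hd1 : 1 ≤ d := by omega
  have hq1 : 1 ≤ q := by omega
  have hKpos : 0 < K := Nat.mul_pos (by omega) (pow_pos (by omega) q)
  -- `n = a(d+1) + b(2d)`
  obtain ⟨a, b, hnab, hna, hnb⟩ := exists_repr hd1 hdn (by omega)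
  have ha1 : 1 ≤ a := by
    by_contra h; push Not at h; interval_cases a; omega
  have hb1 : 1 ≤ b := by
    by_contra h; push Not at h; interval_cases b; omega
  -- the chromatic parameter
  set m₀ := ⌊(d : ℝ) / (4 * Real.logb 2 d)⌋₊ with hm₀
  set t₀ := ⌈(((d + 1) * a : ℕ) : ℝ) / m₀⌉₊ with ht₀
  -- the first lift: `K_{d+1}`, fibres `Fin a`
  have hB₁ : ∀ x : Fin (d + 1), Fintype.card (Fin (d + 1)) ≤ (⊤ : _root_.SimpleGraph (Fin (d + 1))).degree x + 3 := by
    intro x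
    rw [_root_.SimpleGraph.complete_graph_degree, Fintype.card_fin]
    omega
  have hπ₁ : ∃ π₁ : UpEdge (⊤ : _root_.SimpleGraph (Fin (d + 1))) → Equiv.Perm (Fin a),
      IsSparse (liftGraph π₁) (a / (16 * q * (16 * (d + 1)) ^ q)) (1 / q) ∧
      (1 ≤ m₀ → ∀ T : Finset (Fin (d + 1) × Fin a), T.card = t₀ →
        ∃ u ∈ T, ∃ v ∈ T, (liftGraph π₁).Adj u v) := by
    by_cases hm1 : 1 ≤ m₀
    · have hnum : ((Fintype.card (Fin (d + 1)) * a).choose t₀ : ℝ) *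
          Real.exp (-((t₀ : ℝ) ^ 2 - 3 * a * t₀) / (2 * a)) ≤ 1 / 4 := by
        rw [Fintype.card_fin]
        have hnn : (0 : ℝ) ≤ (d : ℝ) / (4 * Real.logb 2 d) :=
          div_nonneg (Nat.cast_nonneg d) (mul_nonneg (by norm_num)
            (Real.logb_nonneg (by norm_num) (by exact_mod_cast hd1)))
        exact independence_numerics (by omega) hm1 (Nat.floor_le hnn) (Nat.le_succ d) ha1
          (Nat.le_ceil _)
      obtain ⟨π₁, hI, hS⟩ := exists_good_lift (B := (⊤ : _root_.SimpleGraph (Fin (d + 1)))) hq1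
        (by rw [Fintype.card_fin]; omega) ha1 hB₁ hnum
      refine ⟨π₁, ?_, fun _ => hI⟩
      rwa [Fintype.card_fin] at hS
    · obtain ⟨π₁, hS⟩ := exists_sparse_lift (B := (⊤ : _root_.SimpleGraph (Fin (d + 1)))) hq1
        (by rw [Fintype.card_fin]; omega) ha1
      refine ⟨π₁, ?_, fun h => absurd h hm1⟩
      rwa [Fintype.card_fin] at hS
  obtain ⟨π₁, hS₁, hI₁⟩ := hπ₁
  -- the second lift: `K_{d,d}`, fibres `Fin b`
  obtain ⟨π₂, hS₂⟩ := exists_sparse_lift (B := completeBipartiteFin d) (a := b) hq1 (by rw [Fintype.card_fin]; omega) hb1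
  rw [Fintype.card_fin] at hS₂
  set L₁ := liftGraph π₁ with hL₁
  set L₂ := liftGraph π₂ with hL₂
  -- the common sparsity range
  set ℓ := min a b / K with hℓ
  have hK₁ : 16 * q * (16 * (d + 1)) ^ q ≤ K := by
    rw [hK]; exact Nat.mul_le_mul_left _ (Nat.pow_le_pow_left (by omega) _)
  have hK₂ : 16 * q * (16 * (2 * d)) ^ q = K := by rw [hK]; ring
  have hℓ₁ : ℓ ≤ a / (16 * q * (16 * (d + 1)) ^ q) :=
    (Nat.div_le_div_right (min_le_left a b)).trans (Nat.div_le_div_left hK₁ (by positivity))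
  have hℓ₂ : ℓ ≤ b / (16 * q * (16 * (2 * d)) ^ q) := by
    rw [hK₂]; exact Nat.div_le_div_right (min_le_right a b)
  have hS₁' : IsSparse L₁ ℓ (1 / q) := fun U hU => hS₁ U (hU.trans hℓ₁)
  have hS₂' : IsSparse L₂ ℓ (1 / q) := fun U hU => hS₂ U (hU.trans hℓ₂)
  have hSum : IsSparse (L₁ ⊕g L₂) ℓ (1 / q) := IsSparse.sum hS₁' hS₂'
  -- transport to `Fin n`
  have hcard : Fintype.card ((Fin (d + 1) × Fin a) ⊕ (Fin (2 * d) × Fin b)) = n := by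
    simp only [Fintype.card_sum, Fintype.card_prod, Fintype.card_fin]
    rw [hnab]; ring
  let e : (Fin (d + 1) × Fin a) ⊕ (Fin (2 * d) × Fin b) ≃ Fin n := Fintype.equivFinOfCardEq hcard
  let G : _root_.SimpleGraph (Fin n) := (L₁ ⊕g L₂).comap e.symm
  let φ : G ≃g L₁ ⊕g L₂ := _root_.SimpleGraph.Iso.comap e.symm (L₁ ⊕g L₂)
  have hφ : ∀ v, φ v = e.symm v := fun _ => rfl
  -- regularity
  have hreg : ∀ v : Fin n, Nat.card (G.neighborSet v) = d := by
    intro v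
    rw [Nat.card_congr (φ.mapNeighborSet v), hφ]
    rcases e.symm v with x | y
    · rw [_root_.SimpleGraph.neighborSet_sum_inl, Nat.card_image_of_injective Sum.inl_injective,
        Nat.card_eq_fintype_card, _root_.SimpleGraph.card_neighborSet_eq_degree]
      exact degree_lift_top π₁ x
    · rw [_root_.SimpleGraph.neighborSet_sum_inr, Nat.card_image_of_injective Sum.inr_injective,
        Nat.card_eq_fintype_card, _root_.SimpleGraph.card_neighborSet_eq_degree]
      exact degree_lift_half π₂ y
  have hdeg : ∀ v : Fin n, G.degree v ≤ d := by
    intro v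
    rw [← _root_.SimpleGraph.card_neighborSet_eq_degree, ← Nat.card_eq_fintype_card, hreg v]
  refine ⟨G, hreg, fun m hm hcol => ?_, fun k hk => ?_⟩
  · -- chromatic window
    rcases Nat.eq_zero_or_pos m with rfl | hmpos
    · rw [_root_.SimpleGraph.colorable_zero_iff] at hcol
      have : 0 < n := by omega
      exact (Fin.pos_iff_nonempty.1 this).elim fun v => hcol.elim v
    · have hmm₀ : m ≤ m₀ := Nat.le_floor hm
      have hm1 : 1 ≤ m₀ := hmpos.trans_le hmm₀ |> fun h => h
      have hcol' : L₁.Colorable m₀ :=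
        _root_.SimpleGraph.Colorable.of_sum_left
          ((hcol.mono hmm₀).of_hom φ.symm.toHom)
      -- a large independent set in `L₁`
      have hlt : m₀ * (t₀ - 1) < Fintype.card (Fin (d + 1) × Fin a) := by
        rw [Fintype.card_prod, Fintype.card_fin, Fintype.card_fin]
        have hm0 : (0 : ℝ) < m₀ := by exact_mod_cast hm1
        have hNpos : (0 : ℝ) < (((d + 1) * a : ℕ) : ℝ) := by exact_mod_cast Nat.mul_pos (Nat.succ_pos d) ha1
        set x : ℝ := (((d + 1) * a : ℕ) : ℝ) / m₀ with hx_def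
        have hx : 0 ≤ x := by positivity
        have hceil : (t₀ : ℝ) < x + 1 := Nat.ceil_lt_add_one hx
        have h1 : ((t₀ - 1 : ℕ) : ℝ) < x := by
          rcases Nat.eq_zero_or_pos t₀ with h0 | hpos
          · rw [h0]
            simp only [Nat.zero_sub, Nat.cast_zero]
            positivity
          · have : ((t₀ - 1 : ℕ) : ℝ) = t₀ - 1 := by rw [Nat.cast_sub hpos, Nat.cast_one]
            rw [this]; linarith
        have h2 : (m₀ : ℝ) * ((t₀ - 1 : ℕ) : ℝ) < (((d + 1) * a : ℕ) : ℝ) := by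
          rw [hx_def, lt_div_iff₀ hm0] at h1; linarith
        exact_mod_cast h2
      obtain ⟨T, hTcard, hT⟩ := exists_independent_of_colorable hcol' hlt
      obtain ⟨u, hu, v, hv, huv⟩ := hI₁ hm1 T hTcard
      exact hT u hu v hv huv
  · -- consistency
    have hkD := mul_pow_le_of_le_rpow hd1 hk
    have hcrude := consts_le_pow hd
    rw [← hq, ← hK] at hcrude
    -- `(d+1) d^d (k + (3k+1)(2d+5)) ≤ ℓ`
    have hstep1 : (d + 1) * d ^ d * (6 * d + 16) * K * (6 * d + 2) * k + B' ≤ n := by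
      have h1 := Nat.mul_le_mul_right k hcrude
      have h2 : 2 * B' ≤ n := by omega
      nlinarith
    have hX : ∀ c : ℕ, n ≤ (6 * d + 2) * c + (6 * d + 1) →
        (d + 1) * d ^ d * (k + (3 * k + 1) * (2 * d + 5)) * K ≤ c := by
      intro c hc
      have h : (6 * d + 2) * ((d + 1) * d ^ d * (k + (3 * k + 1) * (2 * d + 5)) * K) + (6 * d + 1) ≤
          (6 * d + 2) * c + (6 * d + 1) := by
        refine le_trans (le_of_eq ?_) (hstep1.trans hc)
        rw [hB']; ring
      exact Nat.le_of_mul_le_mul_left (by omega) (by omega : 0 < 6 * d + 2)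
    have hkℓ : (d + 1) * d ^ d * (k + (3 * k + 1) * (2 * d + 5)) ≤ ℓ := by
      rw [hℓ, Nat.le_div_iff_mul_le hKpos]
      exact le_min (hX a hna) (hX b hnb)
    -- sparsity in the form of the deterministic theorem
    have hSG : IsSparse G ℓ (1 / (4 * d + 10)) := by
      have h := IsSparse.of_iso φ hSum
      have hε : (1 : ℝ) / (q : ℕ) = 1 / (4 * d + 10) := by rw [hq]; push_cast; ring
      rwa [hε] at h
    exact graphCohomologicallyKConsistent_of_sparse_of_degree_le G hd1 hdeg hSG hkℓ

end Literature.ModelTheory.FiniteModelTheory
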